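import Mathlib.Analysis.SpecificLimits.Normed
import Literature.Combinatorics.Additive.BorderTricoloredSumFree
import Literature.Combinatorics.Additive.TricoloredSumFreeBound
import HarnessLib

/-!
# Pratt 2024, proof of Thm. 4.7: the slice-rank input (BCCGNSU 2017) for STPP families

K. Pratt, *On generalized corners and matrix multiplication*, arXiv:2309.03878 [Pratt2024], proof
of Thm. 4.7 (p. 10): "for all fixed `c > 0` and `ℓ ∈ ℕ`, `G³` cannot contain a subgroup of size
`|G³|^c` generated by elements of order at most `ℓ` by [BCCGNSU 2017]".  The source gives no
further detail; this file PROVES the quantitative statement behind it from the tree's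
formalisation of Blasiak–Church–Cohn–Grochow–Naslund–Sawin–Umans 2017 (fourth step of the
discharge of the named fact `pratt2024_thm47`, `PrattTrapezoidVal.lean`):

* `addEquivPiProd`, `addEquivUncurry`, `addEquivPow_piZMod_prod` — bookkeeping: from
  `K ≃ (ℤ/q)^κ × G'` to `K^N ≃ (ℤ/q)^{N × κ} × G'^N`;
* `le_of_pow_le_mul_sq` — if `x^N ≤ a (2NR+1)²` for all `N` then `x ≤ 1` (polynomial versus
  exponential growth, `tendsto_pow_const_div_const_pow_of_one_lt`);
* `sum_card_div_le_of_addEquiv_piZMod` — **the bound**: for an STPP family `(Aᵢ, Bᵢ, Cᵢ)ᵢ` in a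
  finite abelian group `K ≃ (ℤ/q)^κ × G'`, `q = p^r` a prime power, and any `θ` with
  `#{v ∈ {0..q-1}^n : 3Σv ≤ (q-1)n} ≤ (θq)^n` for all `n` (tree: `exists_theta`),
  `Σᵢ |Aᵢ||Bᵢ||Cᵢ| / (|Aᵢ|+|Bᵢ|+|Cᵢ|) ≤ θ^{|κ|} |K|`.
  Proof = BCCGNSU §3.2 verbatim: Thm. 3.3 (tree: `AddSimultaneousTPP.exists_isBorderTricoloredSumFree`)
  gives a border tricolored sum-free set of that size `m`; Lemma 3.4 (tree:
  `IsBorderTricoloredSumFree.exists_isTricoloredSumFree_pi`) gives tricolored sum-free sets of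
  size `≥ m^N/(2NR+1)²` in `K^N`; Thm. 4.14 in counting form (tree:
  `IsTricoloredSumFree.card_le_of_addEquiv`) bounds those by `3 (θq)^{N|κ|} |G'|^N =
  3 (θ^{|κ|}|K|)^N`; let `N → ∞`.

## References

* [Pratt2024] K. Pratt, arXiv:2309.03878, proof of Thm. 4.7 (p. 10).
* [BlasiakChurchCohnGrochowNaslundSawinUmans2017] Discrete Analysis 2017:3, §3.1 (Thm. 3.3,
  Lemma 3.4), §3.2 (proof of Thm. B), Thm. 4.14, Prop. 4.12.
-/

namespace Literature.Computability.AlgebraicComplexity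

open Finset Filter Literature.Combinatorics.Additive

/-! ### Bookkeeping -/

section Bookkeeping

/-- From `K ≃ (ℤ/q)^κ × G'` to `K^N ≃ (ℤ/q)^{N × κ} × G'^N` (coordinatewise, then regroup and
uncurry). [folklore] -/
theorem nonempty_addEquiv_pi_of_addEquiv {K : Type*} [AddCommGroup K] {q : ℕ} {κ : Type*}
    {G' : Type*} [AddCommGroup G'] (e : K ≃+ (κ → ZMod q) × G') (N : ℕ) :
    Nonempty ((Fin N → K) ≃+ ((Fin N × κ → ZMod q) × (Fin N → G'))) :=
  ⟨(AddEquiv.piCongrRight fun _ : Fin N => e).trans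
    ((AddEquiv.mk' (Equiv.arrowProdEquivProdArrow (Fin N) (fun _ => κ → ZMod q) fun _ => G')
        fun _ _ => rfl).trans
      (AddEquiv.prodCongr (AddEquiv.mk' (Equiv.curry (Fin N) κ (ZMod q)).symm fun _ _ => rfl)
        (AddEquiv.refl _)))⟩

/-- Polynomial versus exponential growth: if `x^N ≤ a (2NR+1)² c^N` for every `N`, with
`c > 0`, then `x ≤ c` (via `N²/y^N → 0` for `y > 1`). [folklore] -/
theorem le_of_pow_le_mul_sq {x c : ℝ} (hc : 0 < c) (a : ℝ) (R : ℕ)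
    (h : ∀ N : ℕ, x ^ N ≤ a * (2 * N * R + 1) ^ 2 * c ^ N) : x ≤ c := by
  by_contra hlt
  push Not at hlt
  have hx : 0 < x := hc.trans hlt
  set y := x / c with hy
  have hy1 : 1 < y := (one_lt_div hc).2 hlt
  have hypos : 0 < y := one_pos.trans hy1
  have hyN : ∀ N : ℕ, y ^ N ≤ a * (2 * N * R + 1) ^ 2 := by
    intro N
    rw [hy, div_pow, div_le_iff₀ (pow_pos hc N)]
    exact h N
  have ha : 1 ≤ a := by simpa using hyN 0
  have hapos : 0 < a := one_pos.trans_le ha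
  set ε : ℝ := 1 / (a * (2 * R + 1) ^ 2) with hε
  have hεpos : 0 < ε := by positivity
  have ht := tendsto_pow_const_div_const_pow_of_one_lt 2 hy1
  obtain ⟨N, hN1, hN⟩ := ((eventually_ge_atTop 1).and (ht.eventually (gt_mem_nhds hεpos))).exists
  have hyNpos : 0 < y ^ N := pow_pos hypos N
  -- `a (2R+1)² N² < y^N`
  have hlow : a * (2 * R + 1) ^ 2 * (N : ℝ) ^ 2 < y ^ N := by
    rw [div_lt_iff₀ hyNpos, hε, div_mul_eq_mul_div, one_mul, lt_div_iff₀ (by positivity)] at hN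
    linarith
  -- `y^N ≤ a (2NR+1)² ≤ a (2R+1)² N²`
  have hup : y ^ N ≤ a * (2 * R + 1) ^ 2 * (N : ℝ) ^ 2 := by
    refine (hyN N).trans ?_
    have hN1' : (1 : ℝ) ≤ N := by exact_mod_cast hN1
    have hR0 : (0 : ℝ) ≤ R := by positivity
    have h1 : (2 * N * R + 1 : ℝ) ≤ (2 * R + 1) * N := by nlinarith
    have h2 : (0 : ℝ) ≤ 2 * N * R + 1 := by positivity
    calc a * (2 * N * R + 1 : ℝ) ^ 2 ≤ a * ((2 * R + 1) * N) ^ 2 := by gcongr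
      _ = a * (2 * R + 1) ^ 2 * (N : ℝ) ^ 2 := by ring
  linarith

end Bookkeeping

/-! ### The bound -/

section Bound

/-- **The slice-rank bound for STPP families** (BCCGNSU 2017, §3.2, the chain
Thm. 3.3 → Lemma 3.4 → Thm. 4.14/Thm. A, here with a homocyclic factor split off as in
Thm. 4.14): if `(Aᵢ, Bᵢ, Cᵢ)ᵢ` is an STPP family in a finite abelian group `K ≃ (ℤ/q)^κ × G'`,
`q = p^r`, and `θ` bounds the low-weight counts, `#{v ∈ {0..q-1}^n : 3Σv ≤ (q-1)n} ≤ (θq)^n`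
for all `n`, then `Σᵢ |Aᵢ||Bᵢ||Cᵢ| / (|Aᵢ|+|Bᵢ|+|Cᵢ|) ≤ θ^{|κ|} · |K|`.  With `θ = θ_q < 1`
(tree: `exists_theta`) this is the power saving used in the proof of Pratt's Thm. 4.7 ("`G³`
cannot contain a subgroup of size `|G³|^c` generated by elements of order at most `ℓ` by
[BCCGNSU]"). [cite: BlasiakChurchCohnGrochowNaslundSawinUmans2017, Thm. B (proof, §3.2)]
[cite: Pratt2024, Thm. 4.7 (proof)] -/
theorem sum_card_div_le_of_addEquiv_piZMod {K : Type*} [AddCommGroup K] [Fintype K]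
    [DecidableEq K] {ι₀ : Type*} [Fintype ι₀] {A B C : ι₀ → Finset K}
    (hS : AddSimultaneousTPP A B C) {p : ℕ} [Fact p.Prime] {q : ℕ} [NeZero q] (r : ℕ)
    (hq : q = p ^ r) {κ : Type} [Fintype κ] [DecidableEq κ] {G' : Type*} [AddCommGroup G']
    [Fintype G'] [DecidableEq G'] (e : K ≃+ (κ → ZMod q) × G') {θ : ℝ} (hθ0 : 0 < θ)
    (hθ : ∀ (κ' : Type) [Fintype κ'] [DecidableEq κ'],
      (Fintype.card (LowWeight q κ') : ℝ) ≤ (θ * q) ^ Fintype.card κ') :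
    ∑ i, (#(A i) * #(B i) * #(C i) : ℝ) / (#(A i) + #(B i) + #(C i)) ≤
      θ ^ Fintype.card κ * Fintype.card K := by
  classical
  obtain ⟨M, α, β, γ, hB, hMcard⟩ := hS.exists_isBorderTricoloredSumFree
  refine hMcard.trans ?_
  -- the range of the weights on `M`
  obtain ⟨R, hR⟩ : ∃ R : ℕ, ∀ x : ↥M, |α x.1| ≤ R ∧ |β x.1| ≤ R := by
    refine ⟨M.sup fun x => (|α x|).toNat + (|β x|).toNat, fun x => ?_⟩
    have hle : (|α x.1|).toNat + (|β x.1|).toNat ≤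
        M.sup fun x => (|α x|).toNat + (|β x|).toNat :=
      Finset.le_sup (f := fun x => (|α x|).toNat + (|β x|).toNat) x.2
    have ha : |α x.1| = ((|α x.1|).toNat : ℤ) := (Int.toNat_of_nonneg (abs_nonneg _)).symm
    have hb : |β x.1| = ((|β x.1|).toNat : ℤ) := (Int.toNat_of_nonneg (abs_nonneg _)).symm
    refine ⟨?_, ?_⟩
    · rw [ha]; exact_mod_cast le_trans (Nat.le_add_right _ _) hle
    · rw [hb]; exact_mod_cast le_trans (Nat.le_add_left _ _) hle
  -- constants
  set m : ℕ := M.card with hm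
  set n := Fintype.card κ with hn
  have hcardK : (Fintype.card K : ℝ) = (q : ℝ) ^ n * Fintype.card G' := by
    have h1 := Fintype.card_congr e.toEquiv
    rw [Fintype.card_prod, Fintype.card_fun, ZMod.card] at h1
    rw [h1]
    push_cast
    rfl
  set c : ℝ := θ ^ n * Fintype.card K with hc
  have hKpos : (0 : ℝ) < Fintype.card K := by exact_mod_cast Fintype.card_pos
  have hcpos : 0 < c := by positivity
  -- the key inequality, for every `N`
  have key : ∀ N : ℕ, (m : ℝ) ^ N ≤ 3 * (2 * N * R + 1) ^ 2 * c ^ N := by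
    intro N
    obtain ⟨M', hT, hcnt⟩ := hB.exists_isTricoloredSumFree_pi R hR N
    obtain ⟨eN⟩ := nonempty_addEquiv_pi_of_addEquiv e N
    have hb := hT.card_le_of_addEquiv (p := p) r hq eN
    rw [Fintype.card_coe, Fintype.card_fun, Fintype.card_fin] at hb
    have hLW : (Fintype.card (LowWeight q (Fin N × κ)) : ℝ) ≤ (θ * q) ^ (N * n) := by
      have hNn : Fintype.card (Fin N × κ) = N * n := by rw [Fintype.card_prod, Fintype.card_fin]
      calc (Fintype.card (LowWeight q (Fin N × κ)) : ℝ) ≤ (θ * q) ^ Fintype.card (Fin N × κ) :=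
            hθ (Fin N × κ)
        _ = (θ * q) ^ (N * n) := by rw [hNn]
    rw [Fintype.card_coe] at hcnt
    have h1 : (m : ℝ) ^ N ≤ (2 * N * R + 1) ^ 2 * (M'.card : ℝ) := by exact_mod_cast hcnt
    have h2 : (M'.card : ℝ) ≤ 3 * (θ * q) ^ (N * n) * (Fintype.card G' : ℝ) ^ N := by
      calc (M'.card : ℝ) ≤ (3 * Fintype.card (LowWeight q (Fin N × κ)) *
            Fintype.card G' ^ N : ℕ) := by exact_mod_cast hb
        _ ≤ 3 * (θ * q) ^ (N * n) * (Fintype.card G' : ℝ) ^ N := by push_cast; gcongr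
    have h3 : 3 * (θ * q) ^ (N * n) * (Fintype.card G' : ℝ) ^ N = 3 * c ^ N := by
      rw [hc, hcardK]
      ring
    calc (m : ℝ) ^ N ≤ (2 * N * R + 1) ^ 2 * (M'.card : ℝ) := h1
      _ ≤ (2 * N * R + 1) ^ 2 * (3 * c ^ N) := by rw [← h3]; gcongr
      _ = 3 * (2 * N * R + 1) ^ 2 * c ^ N := by ring
  exact le_of_pow_le_mul_sq hcpos 3 R key

end Bound

end Literature.Computability.AlgebraicComplexity
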